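import Summits.CriticalPhenomena.SAWScalingLimit.Theorems.SAWDevelopingMapObservableToSLECanonicalTransferDictionary
import Literature.Probability.RandomPlanarGeometry.HexParafermion

-- STATUS (line bridge-gate-renewal, stub 5 `stub_carvedToSLE`, 2026-08-16): rc 0, 0 sorries, 0 warnings; companion of
-- `…ObservableToSLERCarvedDictionary.lean` (independent of it and of the line's GateDefs file).

/-!
# Carved-domain dictionary for the stub `stub_carvedToSLE`, walk level: carved vertex walks of
`Ω_δ` = Duminil-Copin–Smirnov mid-edge walks (line `bridge-gate-renewal` of the crux
`SAWDefectDecoherence.ObservableToSLER`, stmt-CriticalPhenomena-14005)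

Landing target:
`Summits/CriticalPhenomena/SAWScalingLimit/Theorems/SAWDefectDecoherenceObservableToSLERCarvedDictionaryWalks.lean`
(`--supports stmt-CriticalPhenomena-14005`).  Companion (no import either way) of
`…ObservableToSLERCarvedDictionary.lean`, which carries the audit of `CarvedToSLE` and the
vertex-set side (`carvedVerts`, `R6`'s clauses, clean windows).

The conclusion `CarvedToSLE` of the registered stub `stub_carvedToSLE` is about the CARVED LAW
`carvedLaw Ω δ S q q' = (Z)⁻¹ • carvedWeight Ω δ S q q'`,
`carvedWeight Ω δ S q q' = (hexSAWWeight Ω δ q q').restrict {ξ | ∀ x ∈ ξ.walk.support, x ∉ S}`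
(definitions file of the line; here written out, the identification being `rfl`): the critical
law of the VERTEX self-avoiding walks of `Ω_δ = hexDomainGraph Ω δ` (`HexSAW.lean`) from `q` to
`q'` avoiding the removed set `S` (in the line, the union of the two root sides).  The hypothesis
`R6` of the stub speaks about MID-EDGE walks `HexMidEdgeSAW Λ a b` of finite vertex domains
(`HexParafermion.lean`).  This file proves the walk-level dictionary on a CARVED CELL
(standing hypotheses of `section Cell`: `Λ` contains every `S`-avoiding walk of `Ω_δ` from `q` and
misses `S`; every honeycomb edge inside `Λ` is an edge of `Ω_δ` — NO BAD EDGE, the one substantive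
hypothesis, see the companion's audit (ii) —; `q ∉ S ∋ p, p'`, `q ∼ p`, `s(q,p) ≠ s(q',p')`):

* `exists_equiv_avoid_hexMidEdgeSAW` — THE BIJECTION: `S`-avoiding SAWs of `Ω_δ` from `q` to `q'`
  ≃ `HexMidEdgeSAW Λ s(q,p) s(q',p')`, with the SAME list of visited vertices; hence the same
  weight `x_c^{#vertices}` termwise (`vertexCount = length`; no constant, no one-step shift);
* `restrict_avoid_apply_eq_sum`, `restrict_avoid_apply_univ_eq_sum` — the carved weight of
  `{support ∈ B}` is the Duminil-Copin–Smirnov partition sum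
  `Σ_{γ ⊂ Λ : s(q,p) → s(q',p'), verts ∈ B} x_c^{ℓ(γ)}`, the total carved weight is
  `Z_Λ(s(q,p), s(q',p'))`;
* `smul_restrict_avoid_apply_toReal_eq_div` — the carved law is the DCS law `P_Λ` of the mid-edge
  walk of `(Λ; s(q,p), s(q',p'))` (ratio of partition sums) — the object `R6`'s observable
  `F = Σ e^{-iσW} x_c^ℓ` is built from;
* `nonempty_hexMidEdgeSAW_of_avoid` — `R6`'s clause `Nonempty (HexMidEdgeSAW Λ (a δ) (b δ))` from
  one `S`-avoiding walk; `isProbabilityMeasure_smul_restrict_avoid` — the carved law is a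
  probability measure on every cell (no edge hypothesis); `gate_mem_hexDomainBoundary`
  (`R6`'s clause `a δ ∈ hexDomainBoundary`), `gate_sym2_ne`;
* the bookkeeping of the two gates on one vertex list (suffix / reversal conventions of
  `CarvedToSLE` versus `GateDecomposition`): `gate_indices`, `gate_indices_reverse`,
  `gate_index_add_lt`, `gate_list_decomposition`.

With `Λ := carvedVerts (hexDomainGraph Ω δ) S q` (companion file) the first two standing
hypotheses are `mem_carvedVerts_of_mem_support` and `not_mem_of_mem_carvedVerts` there.

Sources: H. Duminil-Copin, S. Smirnov, Ann. of Math. 175 (2012) (arXiv:1007.0575) §1–2 (walks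
between mid-edges, `ℓ` = number of vertices), §4 (the law `P_{x,δ}`); G. Lawler, O. Schramm,
W. Werner, Proc. Sympos. Pure Math. 72 (2004) §3.4 (restriction property of the SAW); the sibling
dictionary `Theorems/SAWDevelopingMapObservableToSLECanonicalTransferDictionary.lean` (crux 10472),
whose bijections `exists_equiv_isPath_of_le`, `exists_equiv_isPath_hexMidEdgeSAW` are reused.
-/

noncomputable section

open scoped BigOperators Topology NNReal ENNReal Classical
open Filter Set MeasureTheory Metric
open Literature.Probability.LatticeModels (HexVertex hexGraph hexCenter triZeta Site)
open Literature.Probability.RandomPlanarGeometry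
open Literature.Probability.RandomPlanarGeometry.SAW

namespace Summit.CriticalPhenomena.SAWScalingLimit.Theorems.ObservableToSLER.BridgeGate

/-! ### Gate mid-edges -/

/-- **`a δ ∈ hexDomainBoundary (Λ δ)`**: a gate mid-edge `s(q, p)` (`q ∈ Λ`, `p ∉ Λ`, `q ∼ p`) is a
boundary mid-edge of the vertex domain `Λ`; likewise `s(q', p')` at the target gate. -/
theorem gate_mem_hexDomainBoundary {Λ : Finset HexVertex} {u pu : HexVertex} (hu : u ∈ Λ)
    (hpu : pu ∉ Λ) (hadj : hexGraph.Adj u pu) : s(u, pu) ∈ hexDomainBoundary Λ :=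
  ⟨(SimpleGraph.mem_edgeSet hexGraph).2 hadj, pu, u, Sym2.eq_swap, hu, hpu⟩

/-- The two gate mid-edges are distinct as soon as `p ≠ p'` and `p ≠ q'` (both hold once the level
hexagon at `a` is two lattice steps away from the one at `b`). -/
theorem gate_sym2_ne {u v pu pv : HexVertex} (h1 : pu ≠ pv) (h2 : pu ≠ v) :
    s(u, pu) ≠ s(v, pv) := by
  intro h
  rcases Sym2.eq_iff.1 h with ⟨-, h'⟩ | ⟨-, h'⟩
  · exact h1 h'
  · exact h2 h'

/-! ### Carved cells: the bijection and the carved weight / law as partition sums -/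

section Cell

variable {Ω : Set ℂ} {δ : ℝ} {S : Set HexVertex} {Λ : Finset HexVertex} {u v pu pv : HexVertex}

/-! A CARVED CELL of `Ω_δ` is given by the standing hypotheses of this section: `Λ` is a finite
vertex set containing every `S`-avoiding walk of `Ω_δ` from the root `u` (`hΛ`) and missing `S`
(`hΛS`) — so `Λ ⊇ carvedVerts (hexDomainGraph Ω δ) S u` of the companion file, with equality the
intended case (`mem_carvedVerts_of_mem_support`, `not_mem_of_mem_carvedVerts` there) —, on which
`Ω_δ` has every honeycomb edge (`hedge`: NO BAD EDGE, the one substantive hypothesis), with root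
`u ∉ S` (`hu`), gate vertices `pu, pv ∈ S` (`hpu`, `hpv`), root gate `u ∼ pu` (`hadj`) and
distinct gate mid-edges (`hne`).  In the line: `u = q`, `pu = p`, `v = q'`, `pv = p'`,
`S = U_δ ∪ U'_δ`. -/

variable (hΛ : ∀ (w : HexVertex) (π : (hexDomainGraph Ω δ).Walk u w),
    (∀ x ∈ π.support, x ∉ S) → ∀ x ∈ π.support, x ∈ Λ)
  (hΛS : ∀ x ∈ Λ, x ∉ S)

include hΛ in
/-- The root is a vertex of the cell. -/
theorem root_mem_of_cell (hu : u ∉ S) : u ∈ Λ :=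
  hΛ u SimpleGraph.Walk.nil (by simpa using hu) u (by simp)

variable (hedge : ∀ x ∈ Λ, ∀ y ∈ Λ, hexGraph.Adj x y → (hexDomainGraph Ω δ).Adj x y)
  (hu : u ∉ S) (hpu : pu ∈ S) (hpv : pv ∈ S) (hadj : hexGraph.Adj u pu)
  (hne : s(u, pu) ≠ s(v, pv))

include hΛ hΛS hedge hu hpu hpv hadj hne

/-- **THE BIJECTION.**  On a carved cell, the `S`-avoiding self-avoiding walks of `Ω_δ` from `u`
to `v` — the support of the carved law — are in bijection with the Duminil-Copin–Smirnov mid-edge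
walks of the vertex domain `Λ` from the boundary mid-edge `s(u, pu)` to `s(v, pv)`, preserving
the list of visited vertices (hence `ℓ = #vertices`: the weights `x_c^ℓ` agree termwise). -/
theorem exists_equiv_avoid_hexMidEdgeSAW :
    ∃ e : {ξ : HexDomainSAW Ω δ u v // ∀ x ∈ ξ.walk.support, x ∉ S} ≃
        HexMidEdgeSAW Λ s(u, pu) s(v, pv), ∀ ξ, (e ξ).verts = ξ.1.walk.support := by
  obtain ⟨e₂, he₂⟩ := ObservableToSLE.FloorRatio.exists_equiv_isPath_of_le
    (embDomainGraph_le hexGraph hexCenter Ω δ) (Λ := (↑Λ : Set HexVertex))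
    (fun x hx y hy hxy => hedge x hx y hy hxy) u v
  obtain ⟨e₃, he₃⟩ := ObservableToSLE.FloorRatio.exists_equiv_isPath_hexMidEdgeSAW (vb := v)
    (root_mem_of_cell hΛ hu) (fun hp => hΛS pu hp hpu) (fun hp => hΛS pv hp hpv) hadj hne
  let e₁ : {ξ : HexDomainSAW Ω δ u v // ∀ x ∈ ξ.walk.support, x ∉ S} ≃
      {p : (hexDomainGraph Ω δ).Walk u v //
        p.IsPath ∧ ∀ w ∈ p.support, w ∈ (↑Λ : Set HexVertex)} :=
    { toFun := fun ξ => ⟨ξ.1.walk, ξ.1.isPath, hΛ v ξ.1.walk ξ.2⟩,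
      invFun := fun p => ⟨⟨p.1, p.2.1⟩, fun x hx => hΛS x (p.2.2 x hx)⟩,
      left_inv := fun _ => rfl,
      right_inv := fun _ => rfl }
  have he₁ : ∀ ξ, (e₁ ξ).1 = ξ.1.walk := fun _ => rfl
  refine ⟨(e₁.trans e₂).trans e₃, fun ξ => ?_⟩
  rw [Equiv.trans_apply, Equiv.trans_apply, he₃, he₂, he₁]

/-- **`Nonempty (HexMidEdgeSAW (Λ δ) (a δ) (b δ))`** (a clause of `R6`) from one `S`-avoiding walk
of `Ω_δ` — on the cells of the line, the walk's own middle piece. -/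
theorem nonempty_hexMidEdgeSAW_of_avoid (ξ : HexDomainSAW Ω δ u v)
    (hξ : ∀ x ∈ ξ.walk.support, x ∉ S) : Nonempty (HexMidEdgeSAW Λ s(u, pu) s(v, pv)) := by
  obtain ⟨e, -⟩ := exists_equiv_avoid_hexMidEdgeSAW hΛ hΛS hedge hu hpu hpv hadj hne
  exact ⟨e ⟨ξ, hξ⟩⟩

/-- **The carved weight as a Duminil-Copin–Smirnov partition sum.**  On a carved cell with finitely
many walks (bounded `Ω`, nonzero mesh: `finite_hexDomainSAW` of
`Theorems/ObservableToSLE/Negative/Identification.lean`), the carved critical weight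
`carvedWeight Ω δ S u v` — which IS
`(hexSAWWeight Ω δ u v).restrict {avoids S}` — of the walks with support in `B` is
`Σ_{γ ⊂ Λ : s(u,pu) → s(v,pv), verts ∈ B} x_c^{ℓ(γ)}`. -/
theorem restrict_avoid_apply_eq_sum [Fintype (HexDomainSAW Ω δ u v)] (B : Set (List HexVertex)) :
    (hexSAWWeight Ω δ u v).restrict {ξ | ∀ x ∈ ξ.walk.support, x ∉ S}
        {ξ | ξ.walk.support ∈ B} =
      ∑ γ : HexMidEdgeSAW Λ s(u, pu) s(v, pv),
        if γ.verts ∈ B then ENNReal.ofReal (hexCriticalFugacity ^ γ.length) else 0 := by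
  obtain ⟨e, he⟩ := exists_equiv_avoid_hexMidEdgeSAW hΛ hΛS hedge hu hpu hpv hadj hne
  rw [Measure.restrict_apply MeasurableSpace.measurableSet_top,
    ObservableToSLE.FloorRatio.embWeight_apply_eq_sum]
  suffices key : ∀ s : Finset (HexDomainSAW Ω δ u v),
      (∀ ξ, ξ ∈ s ↔ (∀ x ∈ ξ.walk.support, x ∉ S) ∧ ξ.walk.support ∈ B) →
      ∑ γ ∈ s, ENNReal.ofReal (hexCriticalFugacity ^ γ.vertexCount) =
        ∑ γ : HexMidEdgeSAW Λ s(u, pu) s(v, pv),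
          if γ.verts ∈ B then ENNReal.ofReal (hexCriticalFugacity ^ γ.length) else 0 by
    refine key _ fun ξ => ?_
    simp only [Finset.mem_filter, Finset.mem_univ, true_and, Set.mem_inter_iff, Set.mem_setOf_eq]
    exact and_comm
  intro s hs
  have hset : s = (Finset.univ.filter fun ξ : HexDomainSAW Ω δ u v =>
      ∀ x ∈ ξ.walk.support, x ∉ S).filter fun ξ => ξ.walk.support ∈ B := by
    ext ξ
    simp only [hs, Finset.mem_filter, Finset.mem_univ, true_and]
  rw [hset, Finset.sum_filter,
    Finset.sum_subtype (p := fun ξ : HexDomainSAW Ω δ u v => ∀ x ∈ ξ.walk.support, x ∉ S)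
      (Finset.univ.filter fun ξ : HexDomainSAW Ω δ u v => ∀ x ∈ ξ.walk.support, x ∉ S)
      (fun ξ => by rw [Finset.mem_filter]; exact ⟨fun h => h.2, fun h => ⟨Finset.mem_univ _, h⟩⟩)]
  refine Fintype.sum_equiv e _ _ fun ξ => ?_
  have hlen : (e ξ).length = ξ.1.vertexCount := by
    rw [HexMidEdgeSAW.length, he, SimpleGraph.Walk.length_support]
    rfl
  rw [hlen, he]

/-- **Total carved weight = `Z_Λ(s(u,pu), s(v,pv))`**, the Duminil-Copin–Smirnov partition function
of the cell. -/
theorem restrict_avoid_apply_univ_eq_sum [Fintype (HexDomainSAW Ω δ u v)] :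
    (hexSAWWeight Ω δ u v).restrict {ξ | ∀ x ∈ ξ.walk.support, x ∉ S} Set.univ =
      ∑ γ : HexMidEdgeSAW Λ s(u, pu) s(v, pv), ENNReal.ofReal (hexCriticalFugacity ^ γ.length) := by
  have h' := restrict_avoid_apply_eq_sum hΛ hΛS hedge hu hpu hpv hadj hne Set.univ
  simp only [Set.mem_univ, Set.setOf_true, if_true] at h'
  exact h'

/-- **THE CARVED LAW IS THE DUMINIL-COPIN–SMIRNOV LAW OF THE CELL.**  On a carved cell with
finitely many walks, the carved law `carvedLaw Ω δ S u v` — which IS `(Z)⁻¹ • carvedWeight Ω δ S u v`,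
`Z = carvedWeight … univ` — of the walks with support in `B` is the ratio
`Σ_{γ ⊂ Λ : s(u,pu) → s(v,pv), verts ∈ B} x_c^{ℓ(γ)} / Z_Λ(s(u,pu), s(v,pv))`, i.e. the law `P_Λ`
of the mid-edge self-avoiding walk of `(Λ; s(u,pu), s(v,pv))`, from which `R6`'s observable
`F = Σ e^{-iσW} x_c^ℓ` is built. -/
theorem smul_restrict_avoid_apply_toReal_eq_div [Fintype (HexDomainSAW Ω δ u v)]
    (B : Set (List HexVertex)) :
    (((((hexSAWWeight Ω δ u v).restrict {ξ | ∀ x ∈ ξ.walk.support, x ∉ S}) Set.univ)⁻¹ •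
        (hexSAWWeight Ω δ u v).restrict {ξ | ∀ x ∈ ξ.walk.support, x ∉ S})
        {ξ | ξ.walk.support ∈ B}).toReal =
      (∑ γ : HexMidEdgeSAW Λ s(u, pu) s(v, pv),
          if γ.verts ∈ B then hexCriticalFugacity ^ γ.length else 0) /
        ∑ γ : HexMidEdgeSAW Λ s(u, pu) s(v, pv), hexCriticalFugacity ^ γ.length := by
  have hx : ∀ n : ℕ, 0 ≤ hexCriticalFugacity ^ n := fun n =>
    pow_nonneg hexCriticalFugacity_pos_lt_one.1.le n
  rw [Measure.smul_apply, smul_eq_mul, ENNReal.toReal_mul, ENNReal.toReal_inv,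
    restrict_avoid_apply_univ_eq_sum hΛ hΛS hedge hu hpu hpv hadj hne,
    restrict_avoid_apply_eq_sum hΛ hΛS hedge hu hpu hpv hadj hne B, inv_mul_eq_div,
    ENNReal.toReal_sum (fun _ _ => ENNReal.ofReal_ne_top),
    ENNReal.toReal_sum (fun γ _ => by split_ifs <;> simp)]
  congr 1
  · refine Finset.sum_congr rfl fun γ _ => ?_
    split_ifs
    · exact ENNReal.toReal_ofReal (hx _)
    · rfl
  · exact Finset.sum_congr rfl fun γ _ => ENNReal.toReal_ofReal (hx _)

end Cell

/-- **The carved law is a probability measure** as soon as one `S`-avoiding walk exists (finitely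
many walks; no edge hypothesis): the junk value `0` of `carvedLaw` does not occur on the cells of
the line. -/
theorem isProbabilityMeasure_smul_restrict_avoid {Ω : Set ℂ} {δ : ℝ} {S : Set HexVertex}
    {u v : HexVertex} [Fintype (HexDomainSAW Ω δ u v)]
    (hex : ∃ ξ : HexDomainSAW Ω δ u v, ∀ x ∈ ξ.walk.support, x ∉ S) :
    IsProbabilityMeasure
      ((((hexSAWWeight Ω δ u v).restrict {ξ | ∀ x ∈ ξ.walk.support, x ∉ S}) Set.univ)⁻¹ •
        (hexSAWWeight Ω δ u v).restrict {ξ | ∀ x ∈ ξ.walk.support, x ∉ S}) := by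
  obtain ⟨ξ, hξ⟩ := hex
  refine ⟨?_⟩
  rw [Measure.smul_apply, smul_eq_mul]
  apply ENNReal.inv_mul_cancel
  · intro h0
    rw [Measure.restrict_apply MeasurableSpace.measurableSet_top, Set.univ_inter] at h0
    have : hexSAWWeight Ω δ u v {ξ} = 0 :=
      measure_mono_null (Set.singleton_subset_iff.2
        (show ξ ∈ {ξ : HexDomainSAW Ω δ u v | ∀ x ∈ ξ.walk.support, x ∉ S} from hξ)) h0
    rw [hexSAWWeight_singleton] at this
    exact absurd this (ENNReal.ofReal_pos.2 (pow_pos hexCriticalFugacity_pos_lt_one.1 _)).ne'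
  · rw [Measure.restrict_apply MeasurableSpace.measurableSet_top, Set.univ_inter,
      ObservableToSLE.FloorRatio.embWeight_apply_eq_sum]
    exact ENNReal.sum_ne_top.2 fun _ _ => ENNReal.ofReal_ne_top

/-! ### Bookkeeping of the two gates on one list (suffix and reversal conventions) -/

section Lists

variable {α : Type*} {l : List α} {m m' : ℕ} {p q p' q' : α}

/-- First-exit data read FORWARDS (`IsFirstExit c n l m p q`): `1 ≤ m < |l|`, `p = l[m-1]`,
`q = l[m]`. -/
theorem gate_indices (hp : (l.take m).getLast? = some p) (hq : (l.drop m).head? = some q) :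
    0 < m ∧ m < l.length ∧ l[m - 1]? = some p ∧ l[m]? = some q := by
  rw [List.head?_drop] at hq
  have hm : m < l.length := by
    by_contra h
    rw [List.getElem?_eq_none (not_lt.1 h)] at hq
    simp at hq
  rw [List.getLast?_take] at hp
  split_ifs at hp with h0
  have hm1 : m - 1 < l.length := by omega
  rw [List.getElem?_eq_getElem hm1, Option.some_or] at hp
  exact ⟨Nat.pos_of_ne_zero h0, hm, by rw [List.getElem?_eq_getElem hm1, hp], hq⟩

/-- First-exit data read BACKWARDS (`IsFirstExit c n l.reverse m' p' q'`): `1 ≤ m' < |l|`,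
`p' = l[|l| - m']`, `q' = l[|l| - 1 - m']` — so on `l` the target gate is crossed `q' → p'`
(junction edge `{q', p'}`, as `GateDecomposition`'s `Adj q' p'`, `w₂ : Walk p' b`). -/
theorem gate_indices_reverse (hp' : (l.reverse.take m').getLast? = some p')
    (hq' : (l.reverse.drop m').head? = some q') :
    0 < m' ∧ m' < l.length ∧ l[l.length - m']? = some p' ∧ l[l.length - 1 - m']? = some q' := by
  obtain ⟨h0, hm, hp, hq⟩ := gate_indices hp' hq'
  rw [List.length_reverse] at hm
  rw [List.getElem?_reverse (show m' - 1 < l.length by omega)] at hp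
  rw [List.getElem?_reverse (show m' < l.length by omega)] at hq
  refine ⟨h0, hm, ?_, hq⟩
  rw [← hp]
  congr 1
  omega

/-- **The two gates are met in order and the middle piece is nonempty** (`m + m' < |l|`) as soon
as the forward prefix `l.take m` (inside the hexagon at `a`) misses the backward prefix
`l.reverse.take m'` (inside the hexagon at `b`) and `p ≠ q'` (the hexagons are not adjacent) —
both automatic once the two level hexagons are two lattice steps apart. -/
theorem gate_index_add_lt (hp : (l.take m).getLast? = some p) (hq : (l.drop m).head? = some q)
    (hp' : (l.reverse.take m').getLast? = some p') (hq' : (l.reverse.drop m').head? = some q')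
    (hsep : ∀ x ∈ l.take m, x ∉ l.reverse.take m') (hpq' : p ≠ q') : m + m' < l.length := by
  obtain ⟨h0, hm, hpi, -⟩ := gate_indices hp hq
  obtain ⟨h0', hm', -, hqi'⟩ := gate_indices_reverse hp' hq'
  have hpmem : p ∈ l.take m := by
    refine List.mem_of_getElem? (i := m - 1) ?_
    rw [List.getElem?_take, if_pos (by omega), hpi]
  by_contra hge
  rcases (not_lt.1 hge).lt_or_eq with hlt | heq
  · refine hsep p hpmem ?_
    rw [List.take_reverse, List.mem_reverse]
    refine List.mem_of_getElem? (i := m - 1 - (l.length - m')) ?_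
    rw [List.getElem?_drop, ← hpi]
    congr 1
    omega
  · apply hpq'
    rw [← Option.some_inj, ← hpi, ← hqi']
    congr 1
    omega

/-- **THE CELL DECOMPOSITION OF THE LIST** (suffix/reversal conventions of `CarvedToSLE` versus
`GateDecomposition`).  With forward first-exit data `(m; p, q)` on `l` and backward data
`(m'; p', q')` on `l.reverse`, in order (`m + m' < |l|`): `l = l₁ ++ mid ++ l₂` with
`l₁ = l.take m` (ends at `p`), `l₂ = l.drop (|l| - m') = (l.reverse.take m').reverse` (starts at
`p'`), and the middle piece `mid` runs from `q` to `q'` and lies inside both `l.drop m` and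
`l.reverse.drop m'` — so the two no-return clauses of `IsGoodGate` (forward: `l.drop m` misses
`S`; backward: `l.reverse.drop m'` misses `T`) make `mid` avoid `S ∪ T`, exactly the support of
`carvedLaw Ω δ (S ∪ T) q q'`. -/
theorem gate_list_decomposition (hp : (l.take m).getLast? = some p)
    (hq : (l.drop m).head? = some q) (hp' : (l.reverse.take m').getLast? = some p')
    (hq' : (l.reverse.drop m').head? = some q') (hlt : m + m' < l.length) :
    l = l.take m ++ (l.drop m).take (l.length - m' - m) ++ l.drop (l.length - m') ∧
      (l.reverse.take m').reverse = l.drop (l.length - m') ∧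
      (l.drop (l.length - m')).head? = some p' ∧
      ((l.drop m).take (l.length - m' - m)).head? = some q ∧
      ((l.drop m).take (l.length - m' - m)).getLast? = some q' ∧
      (∀ x ∈ (l.drop m).take (l.length - m' - m), x ∈ l.drop m ∧ x ∈ l.reverse.drop m') := by
  obtain ⟨h0, hm, -, hqi⟩ := gate_indices hp hq
  obtain ⟨h0', hm', hpi', hqi'⟩ := gate_indices_reverse hp' hq'
  refine ⟨?_, ?_, ?_, ?_, ?_, fun x hx => ⟨List.mem_of_mem_take hx, ?_⟩⟩
  · conv_lhs => rw [← List.take_append_drop m l,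
      ← List.take_append_drop (l.length - m' - m) (l.drop m)]
    rw [List.drop_drop, List.append_assoc]
    congr 3
    omega
  · rw [List.take_reverse, List.reverse_reverse]
  · rw [List.head?_drop, hpi']
  · rw [List.head?_take, if_neg (by omega), List.head?_drop, hqi]
  · rw [List.getLast?_eq_getElem?, List.length_take, List.length_drop, List.getElem?_take,
      if_pos (by omega), List.getElem?_drop, ← hqi']
    congr 1
    omega
  · rw [List.drop_reverse, List.mem_reverse]
    rw [List.take_drop] at hx
    have hx' := List.mem_of_mem_drop hx
    have : m + (l.length - m' - m) = l.length - m' := by omega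
    rwa [this] at hx'

end Lists

/-! ### Registered form -/

/-- **Registered sub-goal `stub_carvedToSLE_lawDictionary`** (crux item stmt-CriticalPhenomena-14005,
line `bridge-gate-renewal`, stub `stub_carvedToSLE`): on a carved cell, THE CARVED LAW IS THE
DUMINIL-COPIN–SMIRNOV LAW of the cell's vertex domain between the two gate mid-edges, in registry
form (see `smul_restrict_avoid_apply_toReal_eq_div`). -/
theorem stub_carvedToSLE_lawDictionary :
    ∀ (Ω : Set ℂ) (δ : ℝ) (S : Set HexVertex) (Λ : Finset HexVertex) (u v pu pv : HexVertex)
      [Fintype (HexDomainSAW Ω δ u v)] (B : Set (List HexVertex)),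
      (∀ (w : HexVertex) (π : (hexDomainGraph Ω δ).Walk u w),
        (∀ x ∈ π.support, x ∉ S) → ∀ x ∈ π.support, x ∈ Λ) →
      (∀ x ∈ Λ, x ∉ S) →
      (∀ x ∈ Λ, ∀ y ∈ Λ, hexGraph.Adj x y → (hexDomainGraph Ω δ).Adj x y) →
      u ∉ S → pu ∈ S → pv ∈ S → hexGraph.Adj u pu → s(u, pu) ≠ s(v, pv) →
      (((((hexSAWWeight Ω δ u v).restrict {ξ | ∀ x ∈ ξ.walk.support, x ∉ S}) Set.univ)⁻¹ •
          (hexSAWWeight Ω δ u v).restrict {ξ | ∀ x ∈ ξ.walk.support, x ∉ S})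
          {ξ | ξ.walk.support ∈ B}).toReal =
        (∑ γ : HexMidEdgeSAW Λ s(u, pu) s(v, pv),
            if γ.verts ∈ B then hexCriticalFugacity ^ γ.length else 0) /
          ∑ γ : HexMidEdgeSAW Λ s(u, pu) s(v, pv), hexCriticalFugacity ^ γ.length :=
  fun _ _ _ _ _ _ _ _ _ B hΛ hΛS hedge hu hpu hpv hadj hne =>
    smul_restrict_avoid_apply_toReal_eq_div hΛ hΛS hedge hu hpu hpv hadj hne B

end Summit.CriticalPhenomena.SAWScalingLimit.Theorems.ObservableToSLER.BridgeGate

end
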